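import Mathlib
import Summits.QuantumFields.YangMills.Theorems.ConvexGribovBodyContinuumLegGivenGapStubRpCoreChord
import HarnessLib

/-!
# `ContinuumLegGivenGap` (stmt-QuantumFields-15828), line `Sketch`, reshape 18: `stub_csclReal` — two lemmas of real analysis (chord in the limit; diagonal extraction)

Support file for the crux item stmt-QuantumFields-15828 (registered glue stub `stub_csclReal` of line `Sketch`,
reshape 18). Two elementary facts of real analysis used by the Cauchy–Schwarz clustering step.

(1) **Chord bound in the limit.** On tori of sizes `ν j → ∞` one has non-negative sequences `s ↦ g j s`,
midpoint log-convex on `[0, ν j]`, with the far value bounded by `C e^{-μ ν j}`. Rescaling by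
`b j := g j 0 + 1/(j+1) > 0` and applying the log-convex chord bound `rpCore_chordBound` gives the sharp
pointwise estimate `g j s ≤ e^{-μ s} · max (b j) (C' ^ θ · (b j) ^ (1 - θ))` with `θ = s / ν j` and
`C' = max C 1`; as `j → ∞`, `θ → 0`, `b j → gl 0`, and continuity of the real power function at `(gl 0, 1)`
shows that the right-hand side tends to `e^{-μ s} · gl 0`, whence `gl s ≤ gl 0 · e^{-μ s}` for the pointwise
limits `gl`.

(2) **Diagonal extraction.** Countably many bounded real sequences converge simultaneously along a strictly
increasing sequence chosen inside any cofinal set `𝓛 ⊆ ℕ`: enumerate a strictly increasing sequence in `𝓛`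
(`Filter.extraction_of_frequently_atTop`) and use sequential compactness of the compact metrisable box
`∏ i, [-M i, M i]` in `ι → ℝ` (`ι` countable).

No definitions, no facts; Mathlib + the landed tree lemma `rpCore_chordBound` only. [folklore]
-/

noncomputable section

namespace Summit.QuantumFields.YangMills.Theorems.ContinuumLegGivenGap

open Filter Topology

/-- **Sharp chord bound, rescaled form.** A non-negative sequence on `0, …, N` (`N > 0`), midpoint
log-convex, with `g 0 ≤ b` (`b > 0`) and `g N ≤ C' e^{-μ N}` (`C' ≥ 1`) satisfies, for every `s ≤ N`,
`g s ≤ e^{-μ s} · max b (C' ^ (s/N) · b ^ (1 - s/N))`. Obtained from `rpCore_chordBound` applied to `g / b`.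
[folklore] -/
theorem csclReal_chordPoint (g : ℕ → ℝ) (N : ℕ) (b C' μ : ℝ) (hN : 0 < N) (hb : 0 < b) (hC' : 1 ≤ C')
    (hpos : ∀ n : ℕ, n ≤ N → 0 ≤ g n)
    (hlc : ∀ s : ℕ, s + 2 ≤ N → g (s + 1) ^ 2 ≤ g s * g (s + 2))
    (h0 : g 0 ≤ b) (hNb : g N ≤ C' * Real.exp (-(μ * N))) :
    ∀ s : ℕ, s ≤ N →
      g s ≤ Real.exp (-(μ * s)) * max b (C' ^ ((s : ℝ) / N) * b ^ (1 - (s : ℝ) / N)) := by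
  intro s hs
  have hNr : (0 : ℝ) < (N : ℝ) := by exact_mod_cast hN
  have hC'0 : 0 < C' := lt_of_lt_of_le one_pos hC'
  set D : ℝ := max 1 (C' / b) with hD
  have hD1 : 1 ≤ D := le_max_left _ _
  have hD0 : 0 < D := lt_of_lt_of_le one_pos hD1
  -- the chord bound for the rescaled sequence `g / b`
  have key : g s / b ≤ 1 * Real.exp (-(μ * s) + Real.log D / N * s) :=
    rpCore_chordBound (fun n => g n / b) N 1 D μ hN le_rfl hD1
      (fun n hn => div_nonneg (hpos n hn) hb.le)
      (fun n h1 h2 => by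
        have h := hlc (n - 1) (by omega)
        have e1 : n - 1 + 1 = n := by omega
        have e2 : n - 1 + 2 = n + 1 := by omega
        rw [e1, e2] at h
        have e3 : g (n - 1) / b * (g (n + 1) / b) = g (n - 1) * g (n + 1) / b ^ 2 := by
          rw [sq]; ring
        show (g n / b) ^ 2 ≤ g (n - 1) / b * (g (n + 1) / b)
        rw [div_pow, e3]
        exact div_le_div_of_nonneg_right h (sq_nonneg _))
      (by
        show g 0 / b ≤ 1
        rw [div_le_one hb]
        exact h0)
      (by
        show g N / b ≤ D * Real.exp (-(μ * N))
        calc g N / b ≤ C' * Real.exp (-(μ * N)) / b := div_le_div_of_nonneg_right hNb hb.le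
          _ = (C' / b) * Real.exp (-(μ * N)) := by ring
          _ ≤ D * Real.exp (-(μ * N)) :=
              mul_le_mul_of_nonneg_right (le_max_right _ _) (Real.exp_pos _).le)
      s hs
  rw [one_mul, div_le_iff₀ hb] at key
  -- `exp (-(μ s) + (log D / N) s) = exp (-(μ s)) * D ^ (s / N)`
  have hrw : Real.exp (-(μ * s) + Real.log D / N * s) =
      Real.exp (-(μ * s)) * D ^ ((s : ℝ) / N) := by
    rw [Real.exp_add, Real.rpow_def_of_pos hD0]
    congr 1
    congr 1
    ring
  rw [hrw] at key
  -- `D ^ θ ≤ max 1 ((C'/b) ^ θ)` and `b (C'/b) ^ θ = C' ^ θ b ^ (1 - θ)`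
  have hDθ : D ^ ((s : ℝ) / N) ≤ max 1 ((C' / b) ^ ((s : ℝ) / N)) := by
    rcases le_total 1 (C' / b) with h | h
    · have e : D = C' / b := by rw [hD]; exact max_eq_right h
      rw [e]
      exact le_max_right _ _
    · have e : D = 1 := by rw [hD]; exact max_eq_left h
      rw [e, Real.one_rpow]
      exact le_max_left _ _
  have hCb : (C' / b) ^ ((s : ℝ) / N) = C' ^ ((s : ℝ) / N) / b ^ ((s : ℝ) / N) :=
    Real.div_rpow hC'0.le hb.le _
  have hb1 : b * (C' ^ ((s : ℝ) / N) / b ^ ((s : ℝ) / N)) =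
      C' ^ ((s : ℝ) / N) * b ^ (1 - (s : ℝ) / N) := by
    rw [Real.rpow_sub hb, Real.rpow_one]
    ring
  calc g s ≤ Real.exp (-(μ * s)) * D ^ ((s : ℝ) / N) * b := key
    _ = Real.exp (-(μ * s)) * (b * D ^ ((s : ℝ) / N)) := by ring
    _ ≤ Real.exp (-(μ * s)) * (b * max 1 ((C' / b) ^ ((s : ℝ) / N))) := by
        gcongr
    _ = Real.exp (-(μ * s)) * max b (C' ^ ((s : ℝ) / N) * b ^ (1 - (s : ℝ) / N)) := by
        rw [mul_max_of_nonneg _ _ hb.le, mul_one, hCb, hb1]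

/-- **Chord bound in the limit.** If `s ↦ g j s` is non-negative and midpoint log-convex on `[0, ν j]`
with `g j (ν j) ≤ C e^{-μ ν j}`, `ν j → ∞`, and `g j s → gl s` pointwise, then `gl s ≤ gl 0 · e^{-μ s}`
for every `s`. [folklore] -/
theorem csclReal_chordLimit (μ C : ℝ) (ν : ℕ → ℕ) (g : ℕ → ℕ → ℝ) (gl : ℕ → ℝ) (hμ : 0 < μ)
    (hν : Tendsto ν atTop atTop)
    (hpos : ∀ j s : ℕ, s ≤ ν j → 0 ≤ g j s)
    (hlc : ∀ j s : ℕ, s + 2 ≤ ν j → g j (s + 1) ^ 2 ≤ g j s * g j (s + 2))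
    (hfar : ∀ j : ℕ, g j (ν j) ≤ C * Real.exp (-(μ * ν j)))
    (hlim : ∀ s : ℕ, Tendsto (fun j => g j s) atTop (𝓝 (gl s))) :
    ∀ s : ℕ, gl s ≤ gl 0 * Real.exp (-(μ * s)) := by
  have _hμ' : 0 ≤ μ := hμ.le
  intro s
  -- constants and the rescaling sequence
  have hC'1 : 1 ≤ max C 1 := le_max_right _ _
  have hC'0 : 0 < max C 1 := lt_of_lt_of_le one_pos hC'1
  have hbpos : ∀ j : ℕ, 0 < g j 0 + 1 / ((j : ℝ) + 1) := fun j => by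
    have h1 : 0 ≤ g j 0 := hpos j 0 (Nat.zero_le _)
    have h2 : (0 : ℝ) < 1 / ((j : ℝ) + 1) := Nat.one_div_pos_of_nat
    linarith
  -- the pointwise bound, eventually
  have hev : ∀ᶠ j in atTop, g j s ≤ Real.exp (-(μ * s)) *
      max (g j 0 + 1 / ((j : ℝ) + 1))
        ((max C 1) ^ ((s : ℝ) / ν j) * (g j 0 + 1 / ((j : ℝ) + 1)) ^ (1 - (s : ℝ) / ν j)) := by
    filter_upwards [hν.eventually (eventually_ge_atTop (s + 1))] with j hj
    have hN : 0 < ν j := by omega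
    refine csclReal_chordPoint (g j) (ν j) _ _ μ hN (hbpos j) hC'1 (fun n hn => hpos j n hn)
      (fun n hn => hlc j n hn) ?_ ?_ s (by omega)
    · have h2 : (0 : ℝ) < 1 / ((j : ℝ) + 1) := Nat.one_div_pos_of_nat
      linarith
    · exact (hfar j).trans (mul_le_mul_of_nonneg_right (le_max_left _ _) (Real.exp_pos _).le)
  -- limits of the ingredients
  have hbl : Tendsto (fun j : ℕ => g j 0 + 1 / ((j : ℝ) + 1)) atTop (𝓝 (gl 0)) := by
    have h := (hlim 0).add tendsto_one_div_add_atTop_nhds_zero_nat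
    rw [add_zero] at h
    exact h
  have hνR : Tendsto (fun j : ℕ => ((ν j : ℕ) : ℝ)) atTop atTop :=
    tendsto_natCast_atTop_atTop.comp hν
  have hθl : Tendsto (fun j : ℕ => (s : ℝ) / ν j) atTop (𝓝 0) := tendsto_const_nhds.div_atTop hνR
  have hCθ : Tendsto (fun j : ℕ => (max C 1) ^ ((s : ℝ) / ν j)) atTop (𝓝 1) := by
    have hc : Tendsto (fun _ : ℕ => max C 1) atTop (𝓝 (max C 1)) := tendsto_const_nhds
    have h := hc.rpow hθl (Or.inl hC'0.ne')
    rw [Real.rpow_zero] at h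
    exact h
  have hbθ : Tendsto (fun j : ℕ => (g j 0 + 1 / ((j : ℝ) + 1)) ^ (1 - (s : ℝ) / ν j)) atTop
      (𝓝 (gl 0)) := by
    have h1 : Tendsto (fun j : ℕ => (1 : ℝ) - (s : ℝ) / ν j) atTop (𝓝 (1 - 0)) :=
      tendsto_const_nhds.sub hθl
    rw [sub_zero] at h1
    have h := hbl.rpow h1 (Or.inr one_pos)
    rw [Real.rpow_one] at h
    exact h
  have hbound := (hbl.max (hCθ.mul hbθ)).const_mul (Real.exp (-(μ * s)))
  rw [one_mul, max_self] at hbound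
  have h := le_of_tendsto_of_tendsto (hlim s) hbound hev
  rw [mul_comm] at h
  exact h

/-- **Diagonal extraction.** Countably many bounded real sequences converge simultaneously along a strictly
increasing sequence chosen inside a cofinal set `𝓛 ⊆ ℕ`. [folklore] -/
theorem csclReal_diagonal (ι : Type) [Countable ι] (𝓛 : Set ℕ) (E : ι → ℕ → ℝ)
    (h𝓛 : ∀ S : ℕ, ∃ S' : ℕ, S' ∈ 𝓛 ∧ S ≤ S') (hE : ∀ i, ∃ M : ℝ, ∀ S, |E i S| ≤ M) :
    ∃ (Sq : ℕ → ℕ) (El : ι → ℝ), StrictMono Sq ∧ (∀ j, Sq j ∈ 𝓛) ∧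
      ∀ i, Tendsto (fun j => E i (Sq j)) atTop (𝓝 (El i)) := by
  -- a strictly increasing sequence inside `𝓛`
  have hfreq : ∃ᶠ n in atTop, n ∈ 𝓛 := by
    rw [frequently_atTop]
    intro a
    obtain ⟨b, hb, hab⟩ := h𝓛 a
    exact ⟨b, hab, hb⟩
  obtain ⟨T, hT, hT𝓛⟩ := extraction_of_frequently_atTop hfreq
  -- sequential compactness of the box `∏ i, [-M i, M i]`
  choose M hM using hE
  have hKc : IsCompact (Set.pi Set.univ (fun i : ι => Set.Icc (-M i) (M i))) :=
    isCompact_univ_pi fun i => isCompact_Icc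
  have hxK : ∀ n : ℕ, (fun i : ι => E i (T n)) ∈ Set.pi Set.univ (fun i : ι => Set.Icc (-M i) (M i)) :=
    fun n => by
    simp only [Set.mem_pi, Set.mem_univ, true_implies, Set.mem_Icc]
    intro i
    exact abs_le.1 (hM i (T n))
  obtain ⟨a, -, φ, hφ, hlim⟩ := hKc.tendsto_subseq hxK
  refine ⟨T ∘ φ, a, hT.comp hφ, fun j => hT𝓛 (φ j), fun i => ?_⟩
  have h := tendsto_pi_nhds.1 hlim i
  exact h

/-- **`stub_csclReal`**: (1) the log-convex chord bound passes to pointwise limits with the constant gone —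
`gl s ≤ gl 0 · e^{-μ s}`; (2) diagonal extraction of a simultaneously convergent subsequence inside a cofinal
set of volumes. [folklore] -/
theorem stub_csclReal :
    (∀ (μ C : ℝ) (ν : ℕ → ℕ) (g : ℕ → ℕ → ℝ) (gl : ℕ → ℝ), 0 < μ → Tendsto ν atTop atTop →
      (∀ j s : ℕ, s ≤ ν j → 0 ≤ g j s) →
      (∀ j s : ℕ, s + 2 ≤ ν j → g j (s + 1) ^ 2 ≤ g j s * g j (s + 2)) →
      (∀ j : ℕ, g j (ν j) ≤ C * Real.exp (-(μ * ν j))) →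
      (∀ s : ℕ, Tendsto (fun j => g j s) atTop (𝓝 (gl s))) →
      ∀ s : ℕ, gl s ≤ gl 0 * Real.exp (-(μ * s))) ∧
    (∀ (ι : Type) [Countable ι] (𝓛 : Set ℕ) (E : ι → ℕ → ℝ),
      (∀ S : ℕ, ∃ S' : ℕ, S' ∈ 𝓛 ∧ S ≤ S') → (∀ i, ∃ M : ℝ, ∀ S, |E i S| ≤ M) →
      ∃ (Sq : ℕ → ℕ) (El : ι → ℝ), StrictMono Sq ∧ (∀ j, Sq j ∈ 𝓛) ∧
        ∀ i, Tendsto (fun j => E i (Sq j)) atTop (𝓝 (El i))) :=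
  ⟨csclReal_chordLimit, fun ι _ 𝓛 E h𝓛 hE => csclReal_diagonal ι 𝓛 E h𝓛 hE⟩

end Summit.QuantumFields.YangMills.Theorems.ContinuumLegGivenGap

end
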